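import Mathlib.MeasureTheory.Measure.GiryMonad
import Mathlib.MeasureTheory.Function.EssSup
import Mathlib.MeasureTheory.Function.LocallyIntegrable
import Mathlib.MeasureTheory.Measure.WithDensity
import Literature.Analysis.FunctionSpaces.PoissonPointProcessExistence
import Literature.Probability.LatticeModels.PoissonDelaunayIsing
import Literature.Probability.RandomPlanarGeometry.HexSAW
import Literature.Probability.RandomPlanarGeometry.PoissonVoronoiGraph
import HarnessLib

/-!
# The critical self-avoiding walk on the Poisson honeycomb: quenched and annealed laws

Topic `Literature/Probability/RandomPlanarGeometry`; definition request `defn-PoissonVoronoiSAWLaw`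
(route `CriticalPhenomena/SAWPoissonHoneycomb`, whose items so far repeat a ~1.9 kB `let`-block for
these objects). The **Poisson honeycomb** is the Voronoi graph `ω.voronoiGraph`
(`PoissonVoronoiGraph.lean`: vertices = Voronoi vertices of the locally finite configuration
`ω : PointConfig ℂ`, i.e. points with `≥ 3` nearest sites; edges = Voronoi edges, i.e. pairs of
vertices whose nearest-site sets share exactly two sites; every other point of `ℂ` is an isolated
vertex) of a Poisson point process `ω` on `ℂ` (`IsPoissonPointProcess`, Kingman 1993, §2.1; a.s.
trivalent). On it we put the self-avoiding-walk measure of Lawler–Schramm–Werner 2004, §3.1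
(weight `β^{-n}` per walk, `β` the connective constant) in the two-point, Dobrushin-domain
normalisation of Duminil-Copin–Smirnov 2012, §4 (the tree's generic embedded layer
`SAW.embLaw G emb Ω δ x a b` of `HexSAW.lean`, here with `V := ℂ`, `emb := id`, mesh `1`), and
average over the environment `ω` ("annealed" law; the environment-wise law is the "quenched" one —
the terminology of SAW in random environment, Lacoin 2013, §1.4).

## Contents (namespace `Literature.Probability.RandomPlanarGeometry.SAW`)

Generic:
* `sawGrowthRate G K = limsup_n (sup_{c ∈ K} cₙ(G, c))^{1/n}` — the exponential growth rate of
  the number of `n`-step SAWs of a graph `G` from roots in `K` (Lacoin 2013, (1.8)/(2.1):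
  `μ(𝒞) := limsup_N Z_N(x)^{1/N}`, "the quenched connective constant"; for `ℤ²` and `K = {0}`
  this is LSW's `β`, by Hammersley–Morton a limit); `sawGrowthRate_mono`.
* `IsPoissonPointProcess.eq_poissonLaw`, `isPoissonPointProcess_poissonLaw_of_forall_singleton`,
  `poissonFunctor_eq_poissonLaw`: THE Poisson law. The tree's `poissonLaw ν`
  (`Literature.Probability.LatticeModels.poissonLaw`, chosen by `Classical.epsilon`) is a Poisson
  point process for every locally finite atomless `ν` on `ℂ` (PROVED existence,
  `existsUnique_isPoissonPointProcess_holds`, Kingman §2.5) and every Poisson law with σ-finite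
  intensity equals it (PROVED uniqueness `IsPoissonPointProcess.unique_holds`, Rényi); so every
  "Poisson functor" `Pois` quantified in the route's items agrees with `poissonLaw`, and the
  definitions below PICK THE LAW instead of carrying `Pois`.

Poisson–Voronoi (prefix `pv`; (a)–(d) of the request, literally the route's inline terms with
`vor ω := ω.voronoiGraph` and `Pois := poissonLaw`):
* (a) `pvGrowthRate ω = sawGrowthRate ω.voronoiGraph (closedBall 0 1)`;
  `pvConnectiveConstant = μ_PV := essSup_ω pvGrowthRate ω` under `poissonLaw volume` (unit
  intensity); `pvCriticalFugacity = x_c := (μ_PV.toReal)⁻¹`.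
* (b) `pvNearestVertex ω Ω z` — a vertex of the discrete domain `Ω₁(ω) = SAW.embMeshDomain
  ω.voronoiGraph id Ω 1` (largest component of the Voronoi graph inside `Ω`, edges = Voronoi
  edges whose segment lies in `Ω̄`) minimising the distance to `z` (`Classical.epsilon`; exists
  when `Ω₁(ω)` is finite and nonempty, `pvNearestVertex_spec`; a.s. unique).
* (c) `pvQuenchedLaw D ω` — the law `P_{x_c}` of the SAW of `Ω₁(ω)` between the vertices nearest
  to the marked points `a = D.pt 0`, `b = D.pt 1` of the Dobrushin domain `D`, weight
  `x_c^{#vertices}`, pushed to `CurveClass ℂ` (polyline through the Voronoi vertices).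
* (d) `pvIntensity ρ δ = δ⁻² ρ dA` (`ENNReal.ofReal ∘ ρ` as a density w.r.t. Lebesgue measure on
  `ℂ`, times `δ⁻²`) and `pvAnnealedLaw ρ D δ = ∫ pvQuenchedLaw D ω d(poissonLaw (pvIntensity ρ δ))(ω)`
  (`Measure.bind`): the ANNEALED critical SAW on the Poisson honeycomb of intensity `δ⁻² ρ dA`.

API proved here: `pvIntensity_apply`, `pvIntensity_singleton` (atomless), `pvIntensity_one`,
`isLocallyFiniteMeasure_pvIntensity` (locally integrable `ρ`) and `locallyIntegrable_of_eqOn_compl`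
(the route's density class: integrable on `D`, `= 1` off `D`),
`isPoissonPointProcess_poissonLaw_pvIntensity`, `embLaw_univ_le_one`/`pvQuenchedLaw_univ_le_one`
(sub-probability; probability iff a SAW between the endpoints exists and the partition function is
finite), `pvAnnealedLaw_apply_le`, `pvAnnealedLaw_apply`/`lintegral_pvAnnealedLaw` (disintegration
under a.e.-measurability of the quenched kernel), `pvAnnealedLaw_univ_le_one`.

## Deliberately NOT here (wanted with the request; construction theorems to be appended)

* a.e.-measurability of the kernel `ω ↦ pvQuenchedLaw D ω` under `poissonLaw ν` (Voronoi vertices,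
  adjacency, largest component and nearest vertices are measurable in the counts off the null set
  of configurations with ties — Last–Penrose 2017 Mecke calculus); without it `Measure.bind` is the
  junk `0` and `pvAnnealedLaw_apply` is only the inequality `pvAnnealedLaw_apply_le`;
* total mass `pvAnnealedLaw 1 D δ univ → 1` as `δ → 0⁺` (the largest component of the honeycomb in
  `D` is unique with high probability);
* `μ_PV ∈ [1, 2]`, a.s. constancy of `pvGrowthRate` and its independence of the root disc
  (Lacoin 2013, Lemma 2.1 for connected graphs) and of the intensity constant (Poisson mapping
  theorem for dilations, Kingman 1993 §2.3); isometry/dilation covariance in law of `pvAnnealedLaw`;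
* the exact quenched restriction / domain-Markov identities (LSW 2004, §3.4.5 transposed to induced
  Voronoi subgraphs).

## References

* G. F. Lawler, O. Schramm, W. Werner, *On the scaling limit of planar self-avoiding walk* (2004),
  §3.1 (`μ_SAW = β^{-n}`, arXiv p. 10), §3.4.5 (restriction). [`LawlerSchrammWerner2004SAW`]
* H. Duminil-Copin, S. Smirnov, Ann. of Math. 175 (2012), §4 (`P_{x,δ}`). [`DuminilCopinSmirnov2012`]
* H. Lacoin, PTRF 159 (2014) 777–808, §1.4 (quenched/annealed), Lemma 2.1. [`Lacoin2013`]
* J. F. C. Kingman, *Poisson Processes* (1993), §2.1–2.5. [`Kingman1993`]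
-/

noncomputable section

open MeasureTheory Filter Metric Set Function
open scoped ENNReal NNReal Topology

namespace Literature.Probability.RandomPlanarGeometry.SAW

open Literature.Analysis.FunctionSpaces
open Literature.Probability.LatticeModels (poissonLaw isPoissonPointProcess_poissonLaw)

/-! ### The SAW growth rate of a graph from a set of roots -/

section GrowthRate

variable {V : Type*} (G : SimpleGraph V)

/-- The **growth rate of self-avoiding walks of `G` rooted in `K`**:
`limsup_{n → ∞} (sup_{c ∈ K} cₙ(G, c))^{1/n} ∈ [0, ∞]`, `cₙ(G, c) = sawCount G c n` the number of
`n`-step SAWs from `c` (for a single root this is Lacoin's `μ(𝒞) := limsup_N Z_N(x)^{1/N}`, the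
quenched connective constant of the graph; on `ℤ²` it is the connective constant `β`, where the
`limsup` is a limit by submultiplicativity). Roots that are not vertices of interest contribute
`cₙ = 0` for `n ≥ 1` when isolated. [cite: Lacoin2013, §2.1 Lemma 2.1 (2.1)] -/
def sawGrowthRate (K : Set V) : ℝ≥0∞ :=
  limsup (fun n : ℕ => (⨆ c : K, (sawCount G (c : V) n : ℝ≥0∞)) ^ (1 / (n : ℝ))) atTop

/-- The growth rate is monotone in the root set. [folklore] -/
theorem sawGrowthRate_mono {K K' : Set V} (h : K ⊆ K') :
    sawGrowthRate G K ≤ sawGrowthRate G K' := by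
  refine limsup_le_limsup (Eventually.of_forall fun n => ?_)
  dsimp only
  refine ENNReal.rpow_le_rpow (iSup_le fun c => ?_) (by positivity)
  exact le_iSup_of_le (⟨c, h c.2⟩ : K') le_rfl

end GrowthRate

/-! ### Sub-probability of the generic SAW law -/

section EmbLaw

variable {V : Type*} (G : SimpleGraph V) (emb : V → ℂ)

/-- `P_{x,δ}` has total mass `≤ 1`: it is a probability measure when the partition function
`Z = embWeight … univ` is positive and finite, and the junk `0` otherwise. [folklore] -/
theorem embLaw_univ_le_one (Ω : Set ℂ) (δ x : ℝ) (a b : V) :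
    embLaw G emb Ω δ x a b univ ≤ 1 := by
  simp only [embLaw, Measure.smul_apply, smul_eq_mul]
  exact ENNReal.inv_mul_le_one _

/-- `P_{x,δ}` is a finite measure. [folklore] -/
instance isFiniteMeasure_embLaw (Ω : Set ℂ) (δ x : ℝ) (a b : V) :
    IsFiniteMeasure (embLaw G emb Ω δ x a b) :=
  ⟨(embLaw_univ_le_one G emb Ω δ x a b).trans_lt ENNReal.one_lt_top⟩

end EmbLaw

/-! ### The Poisson law, chosen -/

section PoissonLaw

/-- **Uniqueness (Rényi; Kingman 1993, §2.1 (2.5)) in the form used here**: any Poisson point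
process law with σ-finite intensity `ν` IS the chosen law `poissonLaw ν` (the tree's proved
`IsPoissonPointProcess.unique_holds`, the given law witnessing existence). A dot-notation
extension of `Literature.Analysis.FunctionSpaces.IsPoissonPointProcess` declared from this file.
[cite: Kingman1993, §2.1 (2.5) and §2.5] -/
theorem _root_.Literature.Analysis.FunctionSpaces.IsPoissonPointProcess.eq_poissonLaw
    {E : Type*} [MetricSpace E] [MeasurableSpace E] {ν : Measure E} [SigmaFinite ν]
    {P : Measure (PointConfig E)} (h : IsPoissonPointProcess ν P) : P = poissonLaw ν :=
  IsPoissonPointProcess.unique_holds h (isPoissonPointProcess_poissonLaw ⟨P, h⟩)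

/-- **Existence (Kingman 1993, §2.5) in the form used here**: for a locally finite atomless
intensity `ν` on `ℂ`, `poissonLaw ν` is a Poisson point process with intensity `ν` (the tree's
proved `existsUnique_isPoissonPointProcess_holds`). [cite: Kingman1993, §2.5 Existence Theorem] -/
theorem isPoissonPointProcess_poissonLaw_of_forall_singleton (ν : Measure ℂ)
    [IsLocallyFiniteMeasure ν] (hν : ∀ z, ν {z} = 0) : IsPoissonPointProcess ν (poissonLaw ν) :=
  isPoissonPointProcess_poissonLaw (existsUnique_isPoissonPointProcess_holds (E := ℂ) ν hν).exists

/-- Every **Poisson functor** `Pois` (an assignment of a Poisson law to every locally finite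
atomless intensity, as quantified in the items of route `SAWPoissonHoneycomb`) agrees with the
chosen law: `Pois ν = poissonLaw ν`. [cite: Kingman1993, §2.1 (2.5) and §2.5] -/
theorem poissonFunctor_eq_poissonLaw {Pois : Measure ℂ → Measure (PointConfig ℂ)}
    (hPois : ∀ ν : Measure ℂ, IsLocallyFiniteMeasure ν → (∀ z : ℂ, ν {z} = 0) →
      IsPoissonPointProcess ν (Pois ν))
    (ν : Measure ℂ) [hν : IsLocallyFiniteMeasure ν] (h0 : ∀ z, ν {z} = 0) :
    Pois ν = poissonLaw ν :=
  (hPois ν hν h0).eq_poissonLaw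

/-- In particular the chosen law is a probability measure. [cite: Kingman1993, §2.1] -/
theorem isProbabilityMeasure_poissonLaw (ν : Measure ℂ) [IsLocallyFiniteMeasure ν]
    (hν : ∀ z, ν {z} = 0) : IsProbabilityMeasure (poissonLaw ν) :=
  (isPoissonPointProcess_poissonLaw_of_forall_singleton ν hν).isProbabilityMeasure

end PoissonLaw

/-! ### The Poisson honeycomb: connective constant, nearest vertices, quenched law -/

section PoissonVoronoi

/-- The SAW growth rate of the Voronoi graph of `ω` from the Voronoi vertices in the closed unit
disc: `limsup_n (sup_{c ∈ B̄(0,1)} cₙ(ω.voronoiGraph, c))^{1/n}` (non-vertices are isolated and do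
not contribute). [cite: Lacoin2013, §1.4 Proposition 1.1 and Lemma 2.1] -/
def pvGrowthRate (ω : PointConfig ℂ) : ℝ≥0∞ :=
  sawGrowthRate ω.voronoiGraph (closedBall (0 : ℂ) 1)

/-- `pvGrowthRate`, unfolded to the route's inline term. [folklore] -/
theorem pvGrowthRate_eq (ω : PointConfig ℂ) :
    pvGrowthRate ω = limsup (fun n : ℕ => (⨆ c : closedBall (0 : ℂ) 1,
      (sawCount ω.voronoiGraph (c : ℂ) n : ℝ≥0∞)) ^ (1 / (n : ℝ))) atTop :=
  rfl

/-- **The (quenched) connective constant `μ_PV` of the Poisson honeycomb**: the essential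
supremum, over the unit-intensity Poisson point process `ω` on `ℂ`, of the SAW growth rate of
`ω.voronoiGraph` from the unit disc (Lacoin's quenched connective constant
`limsup_N Z_N(x)^{1/N}`, made deterministic by `essSup`; on the a.s. trivalent honeycomb
`μ_PV ≤ 2`). LSW's `β` for `ℤ²`. [cite: Lacoin2013, §1.4 Proposition 1.1] -/
def pvConnectiveConstant : ℝ≥0∞ :=
  essSup pvGrowthRate (poissonLaw (volume : Measure ℂ))

/-- **The critical fugacity `x_c = 1/μ_PV`** of the Poisson honeycomb (LSW §3.1: weight `β^{-n}`
per `n`-step walk, the "phase transition at `e^{-α} = 1/β`"). [cite: LawlerSchrammWerner2004SAW, §3.1] -/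
def pvCriticalFugacity : ℝ :=
  (pvConnectiveConstant.toReal)⁻¹

/-- **Nearest domain vertex.** For a configuration `ω`, a domain `Ω` and a point `z`, a vertex of
the discrete domain `Ω₁(ω) = embMeshDomain ω.voronoiGraph id Ω 1` (the largest connected
component of the Voronoi graph with edges the Voronoi edges whose segment lies in `Ω̄`) at
minimal distance from `z` — Duminil-Copin–Smirnov's "`a_δ` and `b_δ` … the vertices of `Ω_δ`
closest to `a` and `b`" on the Poisson honeycomb. Chosen by `Classical.epsilon` (ties have
probability zero); junk when `Ω₁(ω)` has no distance minimiser (e.g. is empty).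
[cite: DuminilCopinSmirnov2012, §4 (before Conjecture 1)] -/
def pvNearestVertex (ω : PointConfig ℂ) (Ω : Set ℂ) (z : ℂ) : ℂ :=
  Classical.epsilon fun v : ℂ => v ∈ embMeshDomain ω.voronoiGraph id Ω 1 ∧
    ∀ w ∈ embMeshDomain ω.voronoiGraph id Ω 1, dist v z ≤ dist w z

/-- When a distance minimiser exists, `pvNearestVertex` is one. [folklore] -/
theorem pvNearestVertex_spec {ω : PointConfig ℂ} {Ω : Set ℂ} {z : ℂ}
    (h : ∃ v : ℂ, v ∈ embMeshDomain ω.voronoiGraph id Ω 1 ∧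
      ∀ w ∈ embMeshDomain ω.voronoiGraph id Ω 1, dist v z ≤ dist w z) :
    pvNearestVertex ω Ω z ∈ embMeshDomain ω.voronoiGraph id Ω 1 ∧
      ∀ w ∈ embMeshDomain ω.voronoiGraph id Ω 1, dist (pvNearestVertex ω Ω z) z ≤ dist w z :=
  Classical.epsilon_spec h

/-- If the discrete domain is finite and nonempty (the case of a bounded `Ω` containing a Voronoi
edge of `ω`), `pvNearestVertex ω Ω z` is a vertex of it at minimal distance from `z`. [folklore] -/
theorem pvNearestVertex_mem {ω : PointConfig ℂ} {Ω : Set ℂ}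
    (hfin : (embMeshDomain ω.voronoiGraph id Ω 1).Finite)
    (hne : (embMeshDomain ω.voronoiGraph id Ω 1).Nonempty) (z : ℂ) :
    pvNearestVertex ω Ω z ∈ embMeshDomain ω.voronoiGraph id Ω 1 ∧
      ∀ w ∈ embMeshDomain ω.voronoiGraph id Ω 1, dist (pvNearestVertex ω Ω z) z ≤ dist w z := by
  obtain ⟨v, hv, hmin⟩ := hfin.exists_minimalFor (fun w => dist w z) _ hne
  exact pvNearestVertex_spec ⟨v, hv, fun w hw => not_lt.1 fun hlt => (hmin hw hlt.le).not_gt hlt⟩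

/-- **The quenched critical SAW law on the Poisson honeycomb** in the Dobrushin domain
`D = (Ω; a, b)` for the environment `ω`: the law `P_{x_c}` (`SAW.embLaw`, weight
`x_c^{#vertices}`, normalised; `V := ℂ`, `emb := id`, mesh `1`) on self-avoiding walks of the
discrete domain `Ω₁(ω)` of the Voronoi graph of `ω` from the vertex nearest to `a = D.pt 0` to the
vertex nearest to `b = D.pt 1`, pushed forward to curves modulo reparametrisation (the polyline
through the visited Voronoi vertices). A sub-probability measure (`pvQuenchedLaw_univ_le_one`);
the junk `0` iff no such SAW exists. [cite: DuminilCopinSmirnov2012, §4 (before Conjecture 1)] -/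
def pvQuenchedLaw (D : DobrushinDomain) (ω : PointConfig ℂ) : Measure (CurveClass ℂ) :=
  (embLaw ω.voronoiGraph id D.carrier 1 pvCriticalFugacity
      (pvNearestVertex ω D.carrier (D.pt 0)) (pvNearestVertex ω D.carrier (D.pt 1))).map
    EmbDomainSAW.curve

/-- `pvQuenchedLaw`, unfolded to the route's inline term (with `vor ω := ω.voronoiGraph`,
cf. `PointConfig.voronoiGraph_eq_fromRel`, and `xc := pvCriticalFugacity`). [folklore] -/
theorem pvQuenchedLaw_eq (D : DobrushinDomain) (ω : PointConfig ℂ) :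
    pvQuenchedLaw D ω = (embLaw ω.voronoiGraph id D.carrier 1 pvCriticalFugacity
      (pvNearestVertex ω D.carrier (D.pt 0)) (pvNearestVertex ω D.carrier (D.pt 1))).map
        fun γ => γ.curve :=
  rfl

/-- The quenched law has total mass `≤ 1` (exactly `1` when a SAW between the two endpoints exists
in `Ω₁(ω)` and the partition function is finite, `0` otherwise). [folklore] -/
theorem pvQuenchedLaw_univ_le_one (D : DobrushinDomain) (ω : PointConfig ℂ) :
    pvQuenchedLaw D ω univ ≤ 1 := by
  rw [pvQuenchedLaw, Measure.map_apply (EmbDomainSAW.measurable_of_top _) MeasurableSet.univ,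
    preimage_univ]
  exact embLaw_univ_le_one _ _ _ _ _ _ _

/-- Every set has quenched mass `≤ 1`. [folklore] -/
theorem pvQuenchedLaw_apply_le_one (D : DobrushinDomain) (ω : PointConfig ℂ)
    (s : Set (CurveClass ℂ)) : pvQuenchedLaw D ω s ≤ 1 :=
  (measure_mono (subset_univ s)).trans (pvQuenchedLaw_univ_le_one D ω)

/-- The quenched law is a finite measure. [folklore] -/
instance isFiniteMeasure_pvQuenchedLaw (D : DobrushinDomain) (ω : PointConfig ℂ) :
    IsFiniteMeasure (pvQuenchedLaw D ω) :=
  ⟨(pvQuenchedLaw_univ_le_one D ω).trans_lt ENNReal.one_lt_top⟩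

end PoissonVoronoi

/-! ### Intensities `δ⁻² ρ dA` and the annealed law -/

section Annealed

/-- **The intensity measure `δ⁻² ρ(z) dA(z)` on `ℂ`**: Lebesgue measure with density
`ENNReal.ofReal ∘ ρ` (negative values of `ρ` truncated to `0`), scaled by `δ⁻²` (so that a typical
Voronoi cell has diameter of order `δ`; `δ = 0` gives the zero measure). Kingman 1993, §2.1: the
mean measure `μ(A) = ∫_A λ(x) dx` of an inhomogeneous Poisson process. [cite: Kingman1993, §2.1] -/
def pvIntensity (ρ : ℂ → ℝ) (δ : ℝ) : Measure ℂ :=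
  ENNReal.ofReal (δ⁻¹ ^ 2) • volume.withDensity fun z => ENNReal.ofReal (ρ z)

/-- The intensity of a set: `δ⁻² ∫_s ρ⁺ dA`. [cite: Kingman1993, §2.1] -/
theorem pvIntensity_apply (ρ : ℂ → ℝ) (δ : ℝ) (s : Set ℂ) :
    pvIntensity ρ δ s = ENNReal.ofReal (δ⁻¹ ^ 2) * ∫⁻ z in s, ENNReal.ofReal (ρ z) := by
  rw [pvIntensity, Measure.smul_apply, smul_eq_mul, withDensity_apply' _ s]

/-- The intensity has no atoms (Lebesgue measure has none), as the intensity of a simple Poisson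
process must. [cite: Kingman1993, §2.2] -/
theorem pvIntensity_singleton (ρ : ℂ → ℝ) (δ : ℝ) (z : ℂ) : pvIntensity ρ δ {z} = 0 := by
  rw [pvIntensity, Measure.smul_apply, smul_eq_mul,
    withDensity_absolutelyContinuous _ _ (measure_singleton z), mul_zero]

/-- At density `ρ ≡ 1` the intensity is `δ⁻²` times Lebesgue measure (the homogeneous Poisson
process of intensity `δ⁻²`). [cite: Kingman1993, §2.1] -/
theorem pvIntensity_one (δ : ℝ) :
    pvIntensity (fun _ => 1) δ = ENNReal.ofReal (δ⁻¹ ^ 2) • (volume : Measure ℂ) := by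
  have h : (fun _ : ℂ => ENNReal.ofReal ((fun _ : ℂ => (1 : ℝ)) 0)) = 1 := by
    ext; simp
  rw [pvIntensity, h, withDensity_one]

/-- Intensities scale quadratically in `δ⁻¹`: `pvIntensity ρ δ = δ⁻² • pvIntensity ρ 1`.
[cite: Kingman1993, §2.3] -/
theorem pvIntensity_eq_smul_one (ρ : ℂ → ℝ) (δ : ℝ) :
    pvIntensity ρ δ = ENNReal.ofReal (δ⁻¹ ^ 2) • pvIntensity ρ 1 := by
  simp [pvIntensity]

/-- A locally integrable density gives a locally finite intensity (the hypothesis of the existence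
theorem). [cite: Kingman1993, §2.5] -/
theorem isLocallyFiniteMeasure_pvIntensity {ρ : ℂ → ℝ} (hρ : LocallyIntegrable ρ volume)
    (δ : ℝ) : IsLocallyFiniteMeasure (pvIntensity ρ δ) := by
  refine ⟨fun z => ?_⟩
  obtain ⟨s, hs, hint⟩ := hρ z
  refine ⟨s, hs, ?_⟩
  rw [pvIntensity_apply]
  refine ENNReal.mul_lt_top ENNReal.ofReal_lt_top ?_
  exact (lintegral_ofReal_le_lintegral_enorm ρ).trans_lt hint.2

/-- The route's density class is locally integrable: a density integrable on the (open, bounded)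
domain and equal to `1` off it. [folklore] -/
theorem locallyIntegrable_of_eqOn_compl {ρ : ℂ → ℝ} {Ω : Set ℂ} (hΩ : MeasurableSet Ω)
    (hint : IntegrableOn ρ Ω volume) (h1 : ∀ z ∉ Ω, ρ z = 1) : LocallyIntegrable ρ volume := by
  rw [locallyIntegrable_iff]
  intro k hk
  have hsplit : k = (k ∩ Ω) ∪ (k \ Ω) := (inter_union_sdiff k Ω).symm
  rw [hsplit]
  refine IntegrableOn.union (hint.mono_set inter_subset_right) ?_
  have hconst : IntegrableOn (fun _ : ℂ => (1 : ℝ)) (k \ Ω) volume :=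
    integrableOn_const (ne_top_of_le_ne_top hk.measure_lt_top.ne (measure_mono sdiff_subset))
  refine (integrableOn_congr_fun (fun z hz => ?_) (hk.isClosed.measurableSet.diff hΩ)).2 hconst
  exact h1 z hz.2

/-- For a locally integrable density, `poissonLaw (pvIntensity ρ δ)` IS the Poisson point process
of intensity `δ⁻² ρ dA` (existence, Kingman 1993 §2.5, and no atoms). [cite: Kingman1993, §2.5] -/
theorem isPoissonPointProcess_poissonLaw_pvIntensity {ρ : ℂ → ℝ}
    (hρ : LocallyIntegrable ρ volume) (δ : ℝ) :
    IsPoissonPointProcess (pvIntensity ρ δ) (poissonLaw (pvIntensity ρ δ)) := by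
  haveI := isLocallyFiniteMeasure_pvIntensity hρ δ
  exact isPoissonPointProcess_poissonLaw_of_forall_singleton _ (pvIntensity_singleton ρ δ)

/-- The homogeneous case `ρ ≡ 1`. [cite: Kingman1993, §2.5] -/
theorem isPoissonPointProcess_poissonLaw_pvIntensity_one (δ : ℝ) :
    IsPoissonPointProcess (pvIntensity (fun _ => 1) δ) (poissonLaw (pvIntensity (fun _ => 1) δ)) :=
  isPoissonPointProcess_poissonLaw_pvIntensity (locallyIntegrable_const 1) δ

/-- **The annealed critical SAW law on the Poisson honeycomb** in the Dobrushin domain `D` at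
mesh `δ` and density `ρ`: the environment average `∫ P^ω_D d(PPP(δ⁻² ρ dA))(ω)` of the quenched
laws (`Measure.bind`; Lacoin's annealed objects are expectations over the environment in the same
way). For `ρ ≡ 1` this is the law "`Q (fun _ => 1) D δ`" of the route; smooth `ρ` are the
transported densities of its density-universality items. [cite: Lacoin2013, §1.4] -/
def pvAnnealedLaw (ρ : ℂ → ℝ) (D : DobrushinDomain) (δ : ℝ) : Measure (CurveClass ℂ) :=
  (poissonLaw (pvIntensity ρ δ)).bind (pvQuenchedLaw D)

/-- `pvAnnealedLaw`, unfolded. [folklore] -/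
theorem pvAnnealedLaw_eq (ρ : ℂ → ℝ) (D : DobrushinDomain) (δ : ℝ) :
    pvAnnealedLaw ρ D δ = (poissonLaw (pvIntensity ρ δ)).bind (pvQuenchedLaw D) :=
  rfl

/-- The annealed mass of a measurable set is at most the average quenched mass (equality under
a.e.-measurability of the kernel, `pvAnnealedLaw_apply`). [folklore] -/
theorem pvAnnealedLaw_apply_le (ρ : ℂ → ℝ) (D : DobrushinDomain) (δ : ℝ) {s : Set (CurveClass ℂ)}
    (hs : MeasurableSet s) :
    pvAnnealedLaw ρ D δ s ≤ ∫⁻ ω, pvQuenchedLaw D ω s ∂(poissonLaw (pvIntensity ρ δ)) :=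
  Measure.bind_apply_le _ hs

/-- **Disintegration**: if the quenched kernel is a.e.-measurable, the annealed mass of a
measurable set is the environment average of its quenched masses. [folklore] -/
theorem pvAnnealedLaw_apply (ρ : ℂ → ℝ) (D : DobrushinDomain) (δ : ℝ)
    (hκ : AEMeasurable (pvQuenchedLaw D) (poissonLaw (pvIntensity ρ δ)))
    {s : Set (CurveClass ℂ)} (hs : MeasurableSet s) :
    pvAnnealedLaw ρ D δ s = ∫⁻ ω, pvQuenchedLaw D ω s ∂(poissonLaw (pvIntensity ρ δ)) :=
  Measure.bind_apply hs hκ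

/-- **Fubini for the annealed law**: under a.e.-measurability of the quenched kernel,
`∫⁻ f d(pvAnnealedLaw) = ∫ (∫⁻ f dP^ω) dPPP(ω)` for measurable `f ≥ 0`. [folklore] -/
theorem lintegral_pvAnnealedLaw (ρ : ℂ → ℝ) (D : DobrushinDomain) (δ : ℝ)
    (hκ : AEMeasurable (pvQuenchedLaw D) (poissonLaw (pvIntensity ρ δ)))
    {f : CurveClass ℂ → ℝ≥0∞} (hf : Measurable f) :
    ∫⁻ x, f x ∂(pvAnnealedLaw ρ D δ) =
      ∫⁻ ω, ∫⁻ x, f x ∂(pvQuenchedLaw D ω) ∂(poissonLaw (pvIntensity ρ δ)) :=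
  Measure.lintegral_bind hκ hf.aemeasurable

/-- For a locally integrable density the annealed law is a sub-probability measure: total mass
`≤ 1` (the environment law is a probability measure and every quenched law has mass `≤ 1`).
[folklore] -/
theorem pvAnnealedLaw_univ_le_one {ρ : ℂ → ℝ} (hρ : LocallyIntegrable ρ volume)
    (D : DobrushinDomain) (δ : ℝ) : pvAnnealedLaw ρ D δ univ ≤ 1 := by
  haveI := (isPoissonPointProcess_poissonLaw_pvIntensity hρ δ).isProbabilityMeasure
  calc pvAnnealedLaw ρ D δ univ
      ≤ ∫⁻ ω, pvQuenchedLaw D ω univ ∂(poissonLaw (pvIntensity ρ δ)) :=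
        pvAnnealedLaw_apply_le ρ D δ MeasurableSet.univ
    _ ≤ ∫⁻ _, 1 ∂(poissonLaw (pvIntensity ρ δ)) :=
        lintegral_mono fun ω => pvQuenchedLaw_univ_le_one D ω
    _ = 1 := by rw [lintegral_one, measure_univ]

/-- In particular the annealed law at a locally integrable density is a finite measure. [folklore] -/
theorem isFiniteMeasure_pvAnnealedLaw {ρ : ℂ → ℝ} (hρ : LocallyIntegrable ρ volume)
    (D : DobrushinDomain) (δ : ℝ) : IsFiniteMeasure (pvAnnealedLaw ρ D δ) :=
  ⟨(pvAnnealedLaw_univ_le_one hρ D δ).trans_lt ENNReal.one_lt_top⟩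

/-- The homogeneous annealed law `Q_{D,δ} = pvAnnealedLaw 1 D δ` has mass `≤ 1`. [folklore] -/
theorem pvAnnealedLaw_one_univ_le_one (D : DobrushinDomain) (δ : ℝ) :
    pvAnnealedLaw (fun _ => 1) D δ univ ≤ 1 :=
  pvAnnealedLaw_univ_le_one (locallyIntegrable_const 1) D δ

end Annealed

end Literature.Probability.RandomPlanarGeometry.SAW
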